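import Summits.CriticalPhenomena.PercolationContinuityZ3.Theorems.PercNearOneGluingNoHeavyQuantFarSunLayerTwoAllK
import Summits.CriticalPhenomena.PercolationContinuityZ3.Theorems.PercNearOneGluingNoHeavyQuantFarSunAvgLargeSigma
import Summits.CriticalPhenomena.PercolationContinuityZ3.Theorems.PercNearOneGluingNoHeavyQuantFarSunChernoffF
import Mathlib.Analysis.Complex.ExponentialBounds
import HarnessLib

/-!
# FAR beyond trees: **`SunFAR K 2` for every `K ≥ 85`** — layer two of FAR on all large hairy cycles (unconditional)

builds on p205010 (kernel theorem, internal audit signed; external expert review pending)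

Support file (`--supports stmt-CriticalPhenomena-4575`), seat `prim-cert-1` (gen 37); memo `prim-cert-1/FROM-prim-cert-1-g37-SURPLUS-FAR.md` §7.
The conditional assembly `HairyCycle.sunFAR_two_of_witGavg_from` (…LayerTwoAllK: kernel `K ≤ 10`, THM A = universal-witness certificate
p376210, THM B = weakest-hair bet …WeakestBet) asks, for `K ≥ K₁`, only for the inequality `witGavg K h 2 ≥ 1` on the region
`R = {2(F − η) < η(Σ − 4)}` (`Σ = Σ h > 4`, `η` the least weight).  LEMMA 1 (`HairyCycle.witGavg_ge_one_of_sum_ge`, …AvgLargeSigma) gives it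
whenever `Σ ≥ 14`; LEMMA 2 (here) shows that on `R` with `K ≥ 85` hairs one has `Σ ≥ 14`:  `R` gives `η(Σ − 2) > 2F`, all `K` weights are
`≥ η` so `η ≤ Σ/85`, whence `F < Σ(Σ−2)/170`; but the Chernoff bound `θ²·P(T ≤ 2) ≤ e^{−(1−θ)Σ}` (`HairyCycle.pow_mul_sum_hairW_count_le_exp`)
forces `F = P(T ≥ 3) ≥ 0.458` on `Σ ∈ (4, 9]` (`θ = 1/2`), `≥ 0.96` on `(9, 11]` and `≥ 0.994` on `(11, 14)` (`θ = 1/4`) — each incompatible.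

* `HairyCycle.exp_neg_six_le`, `HairyCycle.exp_neg_eight_le` — `e^{−6} ≤ 1/403`, `e^{−8} ≤ 1/2980`.
* `HairyCycle.hairV_univ_ge_of_chernoff` — `θ²(1 − F) ≤ e^{−(1−θ)Σ}` for `0 < θ ≤ 1` (now in …ChernoffF, imported).
* **`HairyCycle.sum_ge_fourteen_of_R`** — LEMMA 2.
* **`HairyCycle.sunFAR_two_of_ge`** — `∀ K ≥ 85, SunFAR K 2`.
With `HairyCycle.sunFAR_of_le_ten` and `HairyCycle.sunFAR_eleven_two` this leaves `12 ≤ K ≤ 84` open at layer two (numerically (S-avg) holds from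
`K = 10`; memo §2, §5–§9).  No definitions, no sorries, standard axioms.  [this work]
-/

noncomputable section

namespace Summit.CriticalPhenomena.PercolationContinuityZ3.Theorems.HairyCycle

open Finset
open scoped Classical

variable {K : ℕ}

/-! ## Numerical constants -/

/-- `e^{−6} ≤ 1/403`. [folklore] -/
theorem exp_neg_six_le : Real.exp (-6) ≤ 1 / 403 := by
  have h1 := Real.exp_one_gt_d9
  have h2 : Real.exp 6 = Real.exp 1 ^ 6 := by rw [← Real.exp_nat_mul]; norm_num
  have h3 : (403 : ℝ) ≤ Real.exp 6 := by
    rw [h2]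
    have := pow_le_pow_left₀ (by norm_num) h1.le 6
    have h4 : (403 : ℝ) ≤ (2.7182818283 : ℝ) ^ 6 := by norm_num
    linarith
  rw [Real.exp_neg, inv_le_comm₀ (Real.exp_pos 6) (by norm_num), one_div, inv_inv]
  exact h3

/-- `e^{−8} ≤ 1/2980`. [folklore] -/
theorem exp_neg_eight_le : Real.exp (-8) ≤ 1 / 2980 := by
  have h1 := Real.exp_one_gt_d9
  have h2 : Real.exp 8 = Real.exp 1 ^ 8 := by rw [← Real.exp_nat_mul]; norm_num
  have h3 : (2980 : ℝ) ≤ Real.exp 8 := by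
    rw [h2]
    have := pow_le_pow_left₀ (by norm_num) h1.le 8
    have h4 : (2980 : ℝ) ≤ (2.7182818283 : ℝ) ^ 8 := by norm_num
    linarith
  rw [Real.exp_neg, inv_le_comm₀ (Real.exp_pos 8) (by norm_num), one_div, inv_inv]
  exact h3

/-! ## Chernoff at the full set -/

/-! ## LEMMA 2 -/

/-- **LEMMA 2.**  For `K ≥ 85`, `h ∈ [0,1]` on `range K` with least weight `η = h m` (`m < K`), `Σ = Σ_{k<K} h k > 4` and
`2(F − η) < η(Σ − 4)` (`F = hairV K h 2 (range K)`):  `Σ ≥ 14`. [this work] -/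
theorem sum_ge_fourteen_of_R (hK : 85 ≤ K) {h : ℕ → ℝ} (hh : ∀ k, k < K → 0 ≤ h k ∧ h k ≤ 1) {m : ℕ} (hm : m < K)
    (hmin : ∀ k, k < K → h m ≤ h k) (hS4 : (4 : ℝ) < ∑ k ∈ range K, h k)
    (hR : 2 * (hairV K h 2 (range K) - h m) < h m * (∑ k ∈ range K, h k - 4)) :
    14 ≤ ∑ k ∈ range K, h k := by
  set S := ∑ k ∈ range K, h k with hSdef
  set F := hairV K h 2 (range K) with hFdef
  set η := h m with hηdef
  by_contra hlt
  push Not at hlt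
  -- `η ≤ S/85`
  have hKη : (85 : ℝ) * η ≤ S := by
    have h1 : (K : ℝ) * η ≤ S := by
      rw [hSdef]
      have := Finset.sum_le_sum (s := range K) (f := fun _ => η) (g := h) fun k hk => hmin k (Finset.mem_range.1 hk)
      simpa using this
    have h2 : (85 : ℝ) ≤ K := by exact_mod_cast hK
    have hη0 : 0 ≤ η := (hh m hm).1
    nlinarith [mul_le_mul_of_nonneg_right h2 hη0]
  -- `2F < η(S − 2)` hence `F < S(S−2)/170`
  have hF : 2 * F < η * (S - 2) := by linarith
  have hS2 : 0 < S - 2 := by linarith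
  have hFS : F < S * (S - 2) / 170 := by
    have : η * (S - 2) ≤ S / 85 * (S - 2) := mul_le_mul_of_nonneg_right (by linarith) hS2.le
    have e : S / 85 * (S - 2) = 2 * (S * (S - 2) / 170) := by ring
    linarith
  -- Chernoff lower bounds for `F` on three ranges of `S`
  rcases le_or_gt S 9 with h9 | h9
  · -- `S ∈ (4, 9]`, `θ = 1/2`: `(1/4)(1 − F) ≤ e^{−S/2} ≤ e^{−2}`
    have hc := hairV_univ_ge_of_chernoff hh (θ := 1 / 2) (by norm_num) (by norm_num)
    rw [← hFdef, ← hSdef] at hc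
    have h1 : Real.exp (-(1 - 1 / 2) * S) ≤ Real.exp (-2) := Real.exp_le_exp.2 (by linarith)
    have h2 := exp_neg_two_le
    have hF1 : 0.458 ≤ F := by nlinarith
    nlinarith
  · rcases le_or_gt S 11 with h11 | h11
    · -- `S ∈ (9, 11]`, `θ = 1/4`: `(1/16)(1 − F) ≤ e^{−3S/4} ≤ e^{−6}`
      have hc := hairV_univ_ge_of_chernoff hh (θ := 1 / 4) (by norm_num) (by norm_num)
      rw [← hFdef, ← hSdef] at hc
      have h1 : Real.exp (-(1 - 1 / 4) * S) ≤ Real.exp (-6) := Real.exp_le_exp.2 (by linarith)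
      have h2 := exp_neg_six_le
      have hF1 : 0.96 ≤ F := by nlinarith
      nlinarith
    · -- `S ∈ (11, 14)`, `θ = 1/4`: `(1/16)(1 − F) ≤ e^{−3S/4} ≤ e^{−8}`
      have hc := hairV_univ_ge_of_chernoff hh (θ := 1 / 4) (by norm_num) (by norm_num)
      rw [← hFdef, ← hSdef] at hc
      have h1 : Real.exp (-(1 - 1 / 4) * S) ≤ Real.exp (-8) := Real.exp_le_exp.2 (by linarith)
      have h2 := exp_neg_eight_le
      have hF1 : 0.994 ≤ F := by nlinarith
      nlinarith

/-! ## Layer two for all `K ≥ 85` -/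

/-- **`SunFAR K 2` FOR EVERY `K ≥ 85`.**  FAR at layer two holds on every hairy cycle with at least `85` pendant relays, for all edge
weights: by `sunFAR_two_of_witGavg_from 85`, THM B covering the complement of `R` and, on `R`, LEMMA 2 (`Σ ≥ 14`) with LEMMA 1
(`Σ ≥ 14 ⇒ witGavg ≥ 1`). [this work] -/
theorem sunFAR_two_of_ge : ∀ K : ℕ, 85 ≤ K → SunFAR K 2 := by
  refine sunFAR_two_of_witGavg_from 85 (by norm_num) fun K hK h hh m hm hmin hS4 hR => ?_
  -- all weights are positive: `η = h m > 0`
  have hF0 : 0 ≤ hairV K h 2 (range K) := hairV_nonneg' hh 2 (range K)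
  have hη0 : 0 < h m := by
    by_contra hle
    push Not at hle
    have hη : h m = 0 := le_antisymm hle (hh m hm).1
    rw [hη] at hR
    linarith
  have hpos : ∀ k, k < K → 0 < h k ∧ h k ≤ 1 := fun k hk => ⟨lt_of_lt_of_le hη0 (hmin k hk), (hh k hk).2⟩
  exact witGavg_ge_one_of_sum_ge hpos (sum_ge_fourteen_of_R hK hh hm hmin hS4 hR)

end Summit.CriticalPhenomena.PercolationContinuityZ3.Theorems.HairyCycle

end
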